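import Literature.MathematicalPhysics.QuantumFieldTheory.Balaban1983to89.Node00.Carriers3Leaf
import Literature.MathematicalPhysics.QuantumFieldTheory.Balaban1983to89.Node00.DatumAvLayer
import Literature.MathematicalPhysics.QuantumFieldTheory.Balaban1983to89.Node00.Satisfiable

/-!
# NODE N24 · binder B2 `B16.EndStatementBPrinted D.C` — THE GLUE BY NAME at the NODE 00 worlds of record, Stage 3:
# children N01 ∕ N02 ∕ N04 discharged by name, N03 and N05–N13 + (0.20) + the β-window as DECLARED hypotheses, and «what blocks»
# in kernel form

TRACK A (YM-PLAN §2d, node N24 of 28 = binder (B2) `hB : B16.EndStatementBPrinted D.C` of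
`T4ContinuumYM4Torus.continuumYM4_torus_of_BetaPertH` ∕ `…_of_endpointExistence`), seat `pub-ymgap-dag-n24-a` (prover, -a KNIT-BY-NAME;
ROSTER-D0062 row n24; dag-lead NODE-TABLE v1 row n24; referee ref-D READ-CARD N24).  THEOREMS ONLY, def-free, sorry-free, standard axioms.
The CONVENTIONS OF RECORD block of the root module `Node00.Carriers` applies.  Nothing mathematical is proved here beyond KERNEL
BOOKKEEPING over tree theorems used BY NAME; the file re-proves nothing of Bałaban's and moves no count (N24 is a COMPOSITE: it never
counts before its children — species rule R414 (B)(v), director-ym №5).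

## THE NODE.  Venue statement of record `YMDAG.B2 D := B16.EndStatementBPrinted D.C` (`HOME/lean/ym-dag/N24_B2.lean`), kernel glue
`YMDAG.B2_of_nodes` ≡ `DagBinding.endStatementBPrinted_of_nodesP_interval` (DagBinding :1508): for a binding world `w` on the datum's
construction (`w.C = D.C`) with `0 < w.γ ≤ γ₀`, the thirteen paper nodes at every run (`DagBinding.Nodes (leavesP w P)` ≡
`N01 w P ∧ … ∧ N13 w P`), the RG recursion (0.20) (`rgFlow`, structural) and the β-window `DagBinding.BetaBoundsInInterval w.C.toB12 γ₀ w.b w.βup`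
([Balaban1987RG1] (1.22) p. 264: upper half printed with proof deferred, lower half `b > 0` printed NOWHERE — census T09.F; binder B3∕B4
territory) give (B2).  (B) = [Balaban1989LargeFieldII] Thm 1 p. 355 ∧ [Balaban1988Convergent] Cor. 3 (2.50) p. 264 in the printed
CONDITIONAL form (`B16.EndStatementBPrinted = Thm1Printed ∧ Cor3_250`, B16 :419).

## WHAT THIS FILE PROVES (the glue ELABORATING AGAINST THE CHILDREN'S CURRENT STATEMENTS OF RECORD — NODE 00 Stage 3, `Node00.IsWorldOfRecord₃`,
## p404803; Stage-0 datum `Node00.IsDatumOfRecord₀`, p386661)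
* §1 `N24_nodes_of_children₃`: at a Stage-3 world of record the conjunction `DagBinding.Nodes (leavesP w P)` from TEN declared children —
  N03 `Dag.B6_main`, N05 `B8_main`, N06 `B9_main`, N07 `B11_main`, N08 `B10_main`, N09 `B12_main`, N10 `B13_main`, N11 `B14_main`, N12 `B15_main`,
  N13 `B16_main`, each `∀ P, Dag.Bk_main (leavesP w P)` = the venue's `YMDAG.Nkk w P` BY NAME — the other THREE being tree theorems at Stage 3:
  N01 `Node00.b4_main_of_isWorldOfRecord₃`, N02 `Node00.b5_main_of_isWorldOfRecord₃`, N04 `Node00.b7_main_of_isWorldOfRecord₃` (Carriers3 :155–:163;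
  N04 discharged of record R431, N01∕N02 provisional).
* §2 `N24_at_world₃`: **(B2) at the world's construction `B16.EndStatementBPrinted w.C`** from the Stage-3 world predicate, `0 < w.γ ≤ γ₀`, the ten
  children, `hrg` and `hβ` — `endStatementBPrinted_of_nodesP_interval` BY NAME (`γ₀` uniform: bound BEFORE `∀ P`, READ-CARD trap A4).
  `N24_at_world₃_of_prop26`: the same with N03 entered at ITS current statement of record — modulo exactly the [Balaban1984PropagatorsII] Prop. 2.6
  census `B6.Prop26Printed (kGeoG) (kG)` on the genuine k-level family (`Node00.b6_main_of_isWorldOfRecord₃_of_prop26`, Carriers3Leaf p406936;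
  h26 ⇐ five displayed slots hm2 hl4 hl5 c3 c4, `B6Prop26PrintedStage3KLevelV1.prop26Printed_kLevel_of_slots4` p408671).
* §3 `N24_at_datum₃`: **(B2) for the datum `B16.EndStatementBPrinted D.C`** (`D : T4Continuum.FiniteEpsData F SU(N)`) along the declared frame
  equation `w.C = D.C` — the venue slot `YMDAG.B2_holds` as a term over these binders.
* §4 `window_of_finiteEpsData` (OBSERVATION, count-neutral, for the plan ∕ ref-D): the «window» clause
  `∃ γ₁ > 0, ∀ γ ∈ ]0, γ₁], ∃ P, (D.C P).flow.InInterval γ P.K` of route item stmt-QuantumFields-19183 `StabilityBAtRecord` holds for EVERY finite-ε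
  datum by its ZERO-STEP runs (`K = 0`, `g₀ = γ`; field `FiniteEpsData.fwd`, [Balaban1987RG1] (0.17) p. 255) — so that clause is NOT where non-vacuity
  lives (cf. `B16SmallCouplings.smallCouplingsOccur_of_forwardGenerated`); `N24_stabilityB_body₃`: the item's per-family body at `SU(N)` from a Stage-0
  datum of record, a Stage-3 world on its construction and N24's binders (at `N = 2` this is `StabilityBAtRecord F`'s matrix, which a Literature
  module cannot name).
* §5 NON-VACUITY OF THE FRAME and WHAT BLOCKS, in kernel form: `N24_exists_stage3Params` (admissible Stage-3 parameters with `D = 4` exist),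
  `N24_worlds₃_nonempty` (`∃ w, IsWorldOfRecord₃ w` — the A1 item ref-D l.8917 noted absent from `Node00.Satisfiable`), `N24_frame₃_inhabited` (on EVERY
  four-torus family a Stage-0 datum of record with a Stage-3 world of record ON ITS CONSTRUCTION, `0 < γ`), and `N24_frame₃_admits_nonB`: that frame
  admits objects at which (B2) FAILS (`T4FiniteEpsInhabited.not_endStatementBPrinted_of_stubData`) — HENCE the ten children + β-window of §2 are NOT
  jointly automatic at Stage 3 + Stage 0: the content of N24 sits in N03, N05–N13, `BetaBoundsInInterval` and the Stage-5 pin of `w.C` (R422, R428 (C)).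

## WHICH CHILD BLOCKS (2026-08-25, for the hourly): theorems today — N01, N02, N04 (Stage ≤ 3, by name); N03 modulo the Prop. 2.6 census (5 slots:
hm2 · hl4 · hl5 · c3 · c4).  DECLARED (open) — N05 [B8], N06 [B9], N07 [B11], N08 [B10] (leaf reading Q2 pending), N09 [B12], N10 [B13], N11 [B14],
N12 [B15], N13 [B16]; non-node binders `hrg` ((0.20), structural), `hβ : BetaBoundsInInterval` (β-side = NODE O ∕ (D1)(D4) territory), `hC : w.C = D.C`,
`hγ`, `hγ₀` — admissible as declared binders until NODE 00 Stage 5 pins them (R428 (C)); ETA(N24) = max(N13, β-side).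

## WHAT THIS IS ∕ IS NOT.  IS: the node's glue as ONE discharge-shaped kernel theorem over the pinned carriers of record (R422 typing policy:
world predicate `IsWorldOfRecord₃`, never a closed cluster Prop over the unpinned frame), with every non-theorem child a DECLARED binder BY NAME and
no antecedent refuted or used ex falso.  IS NOT: a discharge of N24 (composite; discharged when its children are); a statement about THE datum of
record D₀ (Stage 5, «none yet»); anything about binders B3–B6, the continuum limit, ℝ⁴, infinite volume, OS axioms, a mass gap or the Clay
problem.  One finite four-torus programme at fixed ε ([Balaban1989LargeFieldII] Thm 1 scope).
-/

noncomputable section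

namespace Literature.MathematicalPhysics.QuantumFieldTheory.Balaban1983to89.Node00

open DagBinding T4Continuum
open B6KLevelCensusIndexV1 (KIdx kGeoG)
open B6Prop26Census2136KLevelV1 (kG)

/-! ## §1. The thirteen paper nodes at a Stage-3 world of record from the ten declared children -/

/-- **`DagBinding.Nodes (leavesP w P)` at a Stage-3 world of record from the ten open children** (N03, N05–N13 as `∀ P, Dag.Bk_main (leavesP w P)`
BY NAME), N01 ∕ N02 ∕ N04 being the tree theorems `b4 ∕ b5 ∕ b7_main_of_isWorldOfRecord₃`.  Conjunct order = `Nodes` (B4, B5, B6, B7, B8, B9, B10,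
B11, B12, B13, B14, B15, B16). [cite: Balaban1989LargeFieldII, Thm 1 p.355 (the thirteen-paper chain it rests on; bookkeeping)] -/
theorem N24_nodes_of_children₃ (w : WorldP) (hw : IsWorldOfRecord₃ w)
    (h03 : ∀ P : B12.RunParams, Dag.B6_main (leavesP w P)) (h05 : ∀ P : B12.RunParams, Dag.B8_main (leavesP w P))
    (h06 : ∀ P : B12.RunParams, Dag.B9_main (leavesP w P)) (h07 : ∀ P : B12.RunParams, Dag.B11_main (leavesP w P))
    (h08 : ∀ P : B12.RunParams, Dag.B10_main (leavesP w P)) (h09 : ∀ P : B12.RunParams, Dag.B12_main (leavesP w P))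
    (h10 : ∀ P : B12.RunParams, Dag.B13_main (leavesP w P)) (h11 : ∀ P : B12.RunParams, Dag.B14_main (leavesP w P))
    (h12 : ∀ P : B12.RunParams, Dag.B15_main (leavesP w P)) (h13 : ∀ P : B12.RunParams, Dag.B16_main (leavesP w P))
    (P : B12.RunParams) : Nodes (leavesP w P) :=
  ⟨b4_main_of_isWorldOfRecord₃ w hw P, b5_main_of_isWorldOfRecord₃ w hw P, h03 P, b7_main_of_isWorldOfRecord₃ w hw P, h05 P, h06 P,
    h08 P, h07 P, h09 P, h10 P, h11 P, h12 P, h13 P⟩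

/-! ## §2. (B2) at the world's construction -/

/-- **N24 · (B2) AT A STAGE-3 WORLD OF RECORD — the glue by name**: `0 < w.γ ≤ γ₀`, the ten open children at every run, the RG recursion (0.20)
along every run and the β-window `BetaBoundsInInterval w.C.toB12 γ₀ w.b w.βup` give the PINNED end statement `B16.EndStatementBPrinted w.C`
(`DagBinding.endStatementBPrinted_of_nodesP_interval` BY NAME; `γ₀` is uniform — bound before `∀ P`).  Every non-theorem input is a declared
binder; nothing is asserted. [cite: Balaban1989LargeFieldII, Thm 1 p.355 + p.391; Balaban1988Convergent, Cor. 3 (2.50) p.264; Balaban1987RG1, (0.20) p.256, (1.22) p.264 (bookkeeping over the pinned form)] -/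
theorem N24_at_world₃ (w : WorldP) (hw : IsWorldOfRecord₃ w) (hγ : 0 < w.γ) {γ₀ : ℝ} (hγ₀ : w.γ ≤ γ₀)
    (h03 : ∀ P : B12.RunParams, Dag.B6_main (leavesP w P)) (h05 : ∀ P : B12.RunParams, Dag.B8_main (leavesP w P))
    (h06 : ∀ P : B12.RunParams, Dag.B9_main (leavesP w P)) (h07 : ∀ P : B12.RunParams, Dag.B11_main (leavesP w P))
    (h08 : ∀ P : B12.RunParams, Dag.B10_main (leavesP w P)) (h09 : ∀ P : B12.RunParams, Dag.B12_main (leavesP w P))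
    (h10 : ∀ P : B12.RunParams, Dag.B13_main (leavesP w P)) (h11 : ∀ P : B12.RunParams, Dag.B14_main (leavesP w P))
    (h12 : ∀ P : B12.RunParams, Dag.B15_main (leavesP w P)) (h13 : ∀ P : B12.RunParams, Dag.B16_main (leavesP w P))
    (hrg : ∀ P : B12.RunParams, (leavesP w P).rgFlow) (hβ : BetaBoundsInInterval w.C.toB12 γ₀ w.b w.βup) :
    B16.EndStatementBPrinted w.C :=
  endStatementBPrinted_of_nodesP_interval w hγ hγ₀
    (fun P => N24_nodes_of_children₃ w hw h03 h05 h06 h07 h08 h09 h10 h11 h12 h13 P) hrg hβ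

/-- **The same glue with N03 entered at ITS current statement of record** — modulo exactly the [Balaban1984PropagatorsII] Prop. 2.6 census on the
genuine k-level family at every admissible Stage-3 parameter tuple (`Node00.b6_main_of_isWorldOfRecord₃_of_prop26`): nine open children, the
census, (0.20) and the β-window give (B2) at the world. [cite: Balaban1989LargeFieldII, Thm 1 p.355 + p.391; Balaban1984PropagatorsII, Prop. 2.6 (2.136)–(2.140) p.247 (the displayed slot; bookkeeping)] -/
theorem N24_at_world₃_of_prop26 (w : WorldP) (hw : IsWorldOfRecord₃ w) (hγ : 0 < w.γ) {γ₀ : ℝ} (hγ₀ : w.γ ≤ γ₀)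
    (h26 : ∀ θ : Stage3Params, θ.toStage1Params.Admissible →
      B6.Prop26Printed (fun i : KIdx θ.d₆ θ.ℓ₆ θ.hd' θ.hL' θ.b₀ θ.b₁ => kGeoG i) (fun i => kG i))
    (h05 : ∀ P : B12.RunParams, Dag.B8_main (leavesP w P))
    (h06 : ∀ P : B12.RunParams, Dag.B9_main (leavesP w P)) (h07 : ∀ P : B12.RunParams, Dag.B11_main (leavesP w P))
    (h08 : ∀ P : B12.RunParams, Dag.B10_main (leavesP w P)) (h09 : ∀ P : B12.RunParams, Dag.B12_main (leavesP w P))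
    (h10 : ∀ P : B12.RunParams, Dag.B13_main (leavesP w P)) (h11 : ∀ P : B12.RunParams, Dag.B14_main (leavesP w P))
    (h12 : ∀ P : B12.RunParams, Dag.B15_main (leavesP w P)) (h13 : ∀ P : B12.RunParams, Dag.B16_main (leavesP w P))
    (hrg : ∀ P : B12.RunParams, (leavesP w P).rgFlow) (hβ : BetaBoundsInInterval w.C.toB12 γ₀ w.b w.βup) :
    B16.EndStatementBPrinted w.C :=
  N24_at_world₃ w hw hγ hγ₀ (b6_main_of_isWorldOfRecord₃_of_prop26 h26 w hw) h05 h06 h07 h08 h09 h10 h11 h12 h13 hrg hβ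

/-! ## §3. (B2) for the datum along the frame equation `w.C = D.C` -/

section Datum

variable {F : T4Family} {N : ℕ} [NeZero N]

/-- **N24 · (B2) FOR THE DATUM** `D : FiniteEpsData F SU(N)` — the venue slot `YMDAG.B2 D := B16.EndStatementBPrinted D.C` as a term over the
READ-CARD whitelist: a Stage-3 world of record `w` ON THE DATUM'S CONSTRUCTION (`hC : w.C = D.C`, declared until Stage 5), `0 < w.γ ≤ γ₀`, the ten open
children by name, (0.20), the β-window. [cite: Balaban1989LargeFieldII, Thm 1 p.355 + p.391; Balaban1988Convergent, Cor. 3 (2.50) p.264 (bookkeeping over the pinned form)] -/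
theorem N24_at_datum₃ (D : FiniteEpsData F (Matrix.specialUnitaryGroup (Fin N) ℂ))
    (w : WorldP) (hw : IsWorldOfRecord₃ w) (hC : w.C = D.C) (hγ : 0 < w.γ) {γ₀ : ℝ} (hγ₀ : w.γ ≤ γ₀)
    (h03 : ∀ P : B12.RunParams, Dag.B6_main (leavesP w P)) (h05 : ∀ P : B12.RunParams, Dag.B8_main (leavesP w P))
    (h06 : ∀ P : B12.RunParams, Dag.B9_main (leavesP w P)) (h07 : ∀ P : B12.RunParams, Dag.B11_main (leavesP w P))
    (h08 : ∀ P : B12.RunParams, Dag.B10_main (leavesP w P)) (h09 : ∀ P : B12.RunParams, Dag.B12_main (leavesP w P))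
    (h10 : ∀ P : B12.RunParams, Dag.B13_main (leavesP w P)) (h11 : ∀ P : B12.RunParams, Dag.B14_main (leavesP w P))
    (h12 : ∀ P : B12.RunParams, Dag.B15_main (leavesP w P)) (h13 : ∀ P : B12.RunParams, Dag.B16_main (leavesP w P))
    (hrg : ∀ P : B12.RunParams, (leavesP w P).rgFlow) (hβ : BetaBoundsInInterval w.C.toB12 γ₀ w.b w.βup) :
    B16.EndStatementBPrinted D.C :=
  hC ▸ N24_at_world₃ w hw hγ hγ₀ h03 h05 h06 h07 h08 h09 h10 h11 h12 h13 hrg hβ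

/-! ## §4. The route item's window clause and per-family body -/

/-- **OBSERVATION (count-neutral): the «window» clause is met by zero-step runs.**  For EVERY finite-ε datum `D` and every `γ > 0` the run with
`K = 0`, `m = 0`, bare coupling `g₀ = γ` has its (only) coupling `g_0 = γ ∈ ]0, γ]` — the field `FiniteEpsData.fwd` (forward generation from the bare
coupling, (0.17)) —, so `∃ γ₁ > 0, ∀ γ ∈ ]0, γ₁], ∃ P, (D.C P).flow.InInterval γ P.K` holds with `γ₁ = 1`.  Hence this clause of route item
stmt-QuantumFields-19183 carries no content beyond (B2); a K-indexed window (`∀ K`, as `DagBinding.EndpointExistence` delivers) would.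
[cite: Balaban1987RG1, (0.17) p.255 (the run starts at the bare coupling; bookkeeping)] -/
theorem window_of_finiteEpsData (D : FiniteEpsData F (Matrix.specialUnitaryGroup (Fin N) ℂ)) :
    ∃ γ₁ : ℝ, 0 < γ₁ ∧ ∀ γ : ℝ, 0 < γ → γ ≤ γ₁ → ∃ P : B12.RunParams, (D.C P).flow.InInterval γ P.K := by
  refine ⟨1, one_pos, fun γ hγ _ => ⟨⟨0, 0, γ⟩, fun k hk => ?_⟩⟩
  obtain rfl : k = 0 := Nat.le_zero.mp hk
  have h0 : (D.C ⟨0, 0, γ⟩).flow.g 0 = γ := D.fwd.1 ⟨0, 0, γ⟩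
  exact ⟨lt_of_lt_of_eq hγ h0.symm, le_of_eq h0⟩

/-- **The per-family body of route item `StabilityBAtRecord` at `SU(N)`** (at `N = 2` literally the item's matrix at `F`, which a Literature module
cannot name): from a Stage-0 datum of record `D` (`Node00.IsDatumOfRecord₀`, the averaging of record), a Stage-3 world of record on its construction
and N24's declared binders — `∃ D, IsDatumOfRecord₀ F N D ∧ B16.EndStatementBPrinted D.C ∧ (window)`, the window by `window_of_finiteEpsData`.
[cite: Balaban1989LargeFieldII, Thm 1 p.355 + p.391; Balaban1987RG1, (0.3)–(0.4) p.253 (the averaging of record; bookkeeping)] -/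
theorem N24_stabilityB_body₃ (D : FiniteEpsData F (Matrix.specialUnitaryGroup (Fin N) ℂ)) (hD : IsDatumOfRecord₀ F N D)
    (w : WorldP) (hw : IsWorldOfRecord₃ w) (hC : w.C = D.C) (hγ : 0 < w.γ) {γ₀ : ℝ} (hγ₀ : w.γ ≤ γ₀)
    (h03 : ∀ P : B12.RunParams, Dag.B6_main (leavesP w P)) (h05 : ∀ P : B12.RunParams, Dag.B8_main (leavesP w P))
    (h06 : ∀ P : B12.RunParams, Dag.B9_main (leavesP w P)) (h07 : ∀ P : B12.RunParams, Dag.B11_main (leavesP w P))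
    (h08 : ∀ P : B12.RunParams, Dag.B10_main (leavesP w P)) (h09 : ∀ P : B12.RunParams, Dag.B12_main (leavesP w P))
    (h10 : ∀ P : B12.RunParams, Dag.B13_main (leavesP w P)) (h11 : ∀ P : B12.RunParams, Dag.B14_main (leavesP w P))
    (h12 : ∀ P : B12.RunParams, Dag.B15_main (leavesP w P)) (h13 : ∀ P : B12.RunParams, Dag.B16_main (leavesP w P))
    (hrg : ∀ P : B12.RunParams, (leavesP w P).rgFlow) (hβ : BetaBoundsInInterval w.C.toB12 γ₀ w.b w.βup) :
    ∃ D : FiniteEpsData F (Matrix.specialUnitaryGroup (Fin N) ℂ), IsDatumOfRecord₀ F N D ∧ B16.EndStatementBPrinted D.C ∧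
      ∃ γ₁ : ℝ, 0 < γ₁ ∧ ∀ γ : ℝ, 0 < γ → γ ≤ γ₁ → ∃ P : B12.RunParams, (D.C P).flow.InInterval γ P.K :=
  ⟨D, hD, N24_at_datum₃ D w hw hC hγ hγ₀ h03 h05 h06 h07 h08 h09 h10 h11 h12 h13 hrg hβ, window_of_finiteEpsData D⟩

end Datum

/-! ## §5. Non-vacuity of the frame, and what blocks (kernel form) -/

/-- **Admissible Stage-3 parameters exist, with `D = 4`**: the root's admissible Stage-1 witness (`Stage1Params.exists_admissible`), coefficient
algebra `ℂ`, torus dimension index `d₆ = D − 1`, block index `ℓ₆ = L − 1`, weight band `b₀ = b₁ = 1`, Lemma-2.1 rate `δ₀ = 2/L`.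
[cite: Balaban1984PropagatorsII, (2.1)–(2.4) p.224, (2.16) p.225 (parameter dictionary; bookkeeping witness)] -/
theorem N24_exists_stage3Params : ∃ θ : Stage3Params, θ.toStage1Params.Admissible ∧ θ.D = 4 := by
  obtain ⟨θ, hθ, hD⟩ := Stage1Params.exists_admissible
  have hL : 1 < θ.L := θ.hL.2
  refine
    ⟨{ θ with
        𝔸 := ℂ, d₆ := θ.D - 1, ℓ₆ := θ.L - 1, hd₆ := (by omega), hℓ₆ := (by omega), b₀ := 1, b₁ := 1,
        hb := ⟨one_pos, le_rfl⟩, δ₀ := 2 / (((θ.L - 1 : ℕ) : ℝ) + 1), hδ₀ := ⟨(by positivity), le_rfl⟩ },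
      hθ, hD⟩

/-- **Stage-3 worlds of record EXIST** (`∃ w, IsWorldOfRecord₃ w`): any binding world re-bound to the N-binding over `carriers₃ θ X` at admissible `θ`
(`isWorldOfRecord₃_of_up`) — so `N24_at_world₃` and the Stage-3 node theorems do not quantify over an empty class. [cite: Balaban1984PropagatorsII, pp.223–250 (objects of record, Stage 3; bookkeeping)] -/
theorem N24_worlds₃_nonempty : ∃ w : WorldP, IsWorldOfRecord₃ w := by
  obtain ⟨θ, hθ, -⟩ := N24_exists_stage3Params
  obtain ⟨X⟩ := nonempty_printedCarriersR
  obtain ⟨Y⟩ := nonempty_printedCarriers9X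
  obtain ⟨Z⟩ := nonempty_printedCarriers11
  obtain ⟨V⟩ := nonempty_printedCarriers14R
  obtain ⟨W⟩ := nonempty_printedCarriers15
  obtain ⟨w⟩ := nonempty_worldP
  exact ⟨WorldP.withUp w fun _ => Upstream.ofPrintedAllXPN (carriers₃ θ X) Y Z V W, isWorldOfRecord₃_of_up θ hθ X Y Z V W _ rfl⟩

section Frame

variable (F : T4Family) (N : ℕ) [NeZero N]

/-- **THE N24 FRAME IS INHABITED ON EVERY FAMILY**: a Stage-0 datum of record (the placeholder `T4FiniteEpsInhabited.stubData` ON THE AVERAGING OF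
RECORD `Node00.avOfRecord`) together with a Stage-3 world of record on its construction with `0 < γ` — so the binders `hD`, `hw`, `hC`, `hγ` of
`N24_stabilityB_body₃` are jointly satisfiable; the CHILDREN are where the content is (next theorem). [cite: Balaban1987RG1, (0.3)–(0.4) p.253; Balaban1984PropagatorsII, pp.223–250 (objects of record; bookkeeping)] -/
theorem N24_frame₃_inhabited :
    ∃ (D : FiniteEpsData F (Matrix.specialUnitaryGroup (Fin N) ℂ)) (w : WorldP),
      IsDatumOfRecord₀ F N D ∧ IsWorldOfRecord₃ w ∧ w.C = D.C ∧ 0 < w.γ := by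
  obtain ⟨θ, hθ, -⟩ := N24_exists_stage3Params
  obtain ⟨X⟩ := nonempty_printedCarriersR
  obtain ⟨Y⟩ := nonempty_printedCarriers9X
  obtain ⟨Z⟩ := nonempty_printedCarriers11
  obtain ⟨V⟩ := nonempty_printedCarriers14R
  obtain ⟨W⟩ := nonempty_printedCarriers15
  let D : FiniteEpsData F (Matrix.specialUnitaryGroup (Fin N) ℂ) :=
    T4FiniteEpsInhabited.stubData F (Matrix.specialUnitaryGroup (Fin N) ℂ) (avOfRecord F N) (avOfRecord_measurable F N)
      (fun K k hk => avOfRecord_haarAC F N K k hk)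
  refine ⟨D, ⟨D.C, 1, fun _ => 0, fun _ => 0, 1, 1, one_pos, 1, one_pos, 2, one_lt_two, 1,
    fun _ => Upstream.ofPrintedAllXPN (carriers₃ θ X) Y Z V W⟩, rfl, isWorldOfRecord₃_of_up θ hθ X Y Z V W _ rfl, rfl, one_pos⟩

/-- **… AND IT ADMITS OBJECTS AT WHICH (B2) FAILS** (`T4FiniteEpsInhabited.not_endStatementBPrinted_of_stubData`): the Stage-0 ∕ Stage-3 pins and
the frame binders do NOT imply (B2) — the ten children, the β-window and the Stage-5 pin of the construction are where N24's content sits (which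
child blocks: all declared ones). [cite: Balaban1989LargeFieldII, Thm 1 p.355 (what is NOT automatic at the placeholder; bookkeeping)] -/
theorem N24_frame₃_admits_nonB :
    ∃ (D : FiniteEpsData F (Matrix.specialUnitaryGroup (Fin N) ℂ)) (w : WorldP),
      IsDatumOfRecord₀ F N D ∧ IsWorldOfRecord₃ w ∧ w.C = D.C ∧ 0 < w.γ ∧ ¬ B16.EndStatementBPrinted D.C := by
  obtain ⟨θ, hθ, -⟩ := N24_exists_stage3Params
  obtain ⟨X⟩ := nonempty_printedCarriersR
  obtain ⟨Y⟩ := nonempty_printedCarriers9X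
  obtain ⟨Z⟩ := nonempty_printedCarriers11
  obtain ⟨V⟩ := nonempty_printedCarriers14R
  obtain ⟨W⟩ := nonempty_printedCarriers15
  let D : FiniteEpsData F (Matrix.specialUnitaryGroup (Fin N) ℂ) :=
    T4FiniteEpsInhabited.stubData F (Matrix.specialUnitaryGroup (Fin N) ℂ) (avOfRecord F N) (avOfRecord_measurable F N)
      (fun K k hk => avOfRecord_haarAC F N K k hk)
  exact ⟨D, ⟨D.C, 1, fun _ => 0, fun _ => 0, 1, 1, one_pos, 1, one_pos, 2, one_lt_two, 1,
    fun _ => Upstream.ofPrintedAllXPN (carriers₃ θ X) Y Z V W⟩, rfl, isWorldOfRecord₃_of_up θ hθ X Y Z V W _ rfl, rfl, one_pos,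
    T4FiniteEpsInhabited.not_endStatementBPrinted_of_stubData F _ (avOfRecord F N) (avOfRecord_measurable F N)
      (fun K k hk => avOfRecord_haarAC F N K k hk)⟩

end Frame

end Literature.MathematicalPhysics.QuantumFieldTheory.Balaban1983to89.Node00

end
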